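import Mathlib
import HarnessLib

/-!
# ValiantsHypothesis / LacunarySymmetroid — crux `MatrixDescartes` (stmt-ValiantsHypothesis-18050, V1),
# line `Cruxes/MatrixDescartes/Lines/osculation_law.lean` («osculation-law»), stub `stub_recursion` (ROUTE′):
# CONTINUITY OF THE SORTED ROOTS OF A MONIC REAL-ROOTED POLYNOMIAL FAMILY

For the crossing-tolerant peel inequality at `s = 0` (`peelPrime`, NOTE-p7g13-18050-GP-density-sizing.md §5) the branches of the
spectral curve `Φ(t,b) = det(G(t) + b·1) = 0` are taken to be the SORTED roots `β₀(t) ≤ β₁(t) ≤ ⋯ ≤ β_{m−1}(t)` of the monic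
real-rooted fibre `P t = Φ(t, ·)`.  This file proves the one analytic input: for a family `P : ℝ → ℝ[X]` that is monic of constant
degree `m`, real-rooted and coefficientwise continuous on a set `U`, the sorted roots are CONTINUOUS on `U` (no simplicity of roots
assumed — sorted roots touch at eigenvalue crossings but never cross).

Proof (elementary, no Rouché): along any sequence `t_n → t₀` inside `U`, the root vectors are bounded (a monic root bound by the
coefficients), so a subsequence converges to some sorted vector `σ`; evaluating `P t_n = Π_k (X − β_k(t_n))` at every real point
and passing to the limit gives `P t₀ = Π_k (X − σ_k)` (`Polynomial.funext`), whence the sorted roots of `P t₀` ARE `σ`; every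
subsequence having a further subsequence with the right limit, `β_k(t_n) → β_k(t₀)` (`Filter.tendsto_of_subseq_tendsto`).

* `abs_le_of_isRoot_of_monic` — `|r| ≤ 1 + Σ_{k<deg} |coeff_k|` for a root of a monic real polynomial.
* `sort_roots_length`, `roots_eq_map_sortedRoot`, `sortedRoot_le_succ`, `isRoot_sortedRoot` — the sorted enumeration
  `k ↦ ((P t).roots.sort (· ≤ ·)).getD k 0` of the roots of a real-rooted polynomial of degree `m`.
* `eq_prod_of_tendsto` — limit identification: coefficientwise limit of `Π_k (X − v_n k)` with `v_n → σ` is `Π_k (X − σ_k)`.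
* **`exists_sortedRoots`** — the package: root functions `β k`, `k < m`, enumerating the roots with multiplicity, sorted, and
  `ContinuousOn U`.

Honest framing: an analytic LEMMA toward the OPEN stub `stub_recursion`; nothing of the summit is proved; `VP ≠ VNP` is NOT proved.
No definitions (the root functions are produced existentially), no named facts.
-/

-- `Summit.ValiantsHypothesis.ValiantsHypothesis.…` is the tree's mandated single-conjunct layout (Sub = Summit).
set_option linter.dupNamespace false

noncomputable section

namespace Summit.ValiantsHypothesis.ValiantsHypothesis.Theorems.LacunarySymmetroidMatrixDescartes

open Polynomial Set Filter
open scoped BigOperators Topology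

namespace OsculationPeel

/-! ### A root bound for monic real polynomials -/

/-- **Root bound**: a root `r` of a monic real polynomial satisfies `|r| ≤ 1 + Σ_{k < deg} |coeff_k|`. [folklore] -/
theorem abs_le_of_isRoot_of_monic (p : ℝ[X]) (hp : p.Monic) {r : ℝ} (hr : p.IsRoot r) :
    |r| ≤ 1 + ∑ k ∈ Finset.range p.natDegree, |p.coeff k| := by
  have hS : 0 ≤ ∑ k ∈ Finset.range p.natDegree, |p.coeff k| := Finset.sum_nonneg fun _ _ => abs_nonneg _
  by_cases h1 : |r| ≤ 1
  · linarith
  push Not at h1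
  set m := p.natDegree with hm
  -- `r^m = -Σ_{k<m} a_k r^k`
  have heval : r ^ m + ∑ k ∈ Finset.range m, p.coeff k * r ^ k = 0 := by
    have h := hr
    rw [IsRoot, hp.as_sum, eval_add, eval_pow, eval_X, eval_finsetSum] at h
    simp only [eval_mul, eval_C, eval_pow, eval_X] at h
    exact h
  have hm0 : 0 < m := by
    rcases Nat.eq_zero_or_pos m with h0 | h0
    · exfalso
      rw [h0, pow_zero, Finset.range_zero, Finset.sum_empty, add_zero] at heval
      exact one_ne_zero heval
    · exact h0
  -- `|r|^m ≤ (Σ |a_k|) |r|^(m-1)`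
  have hle : |r| ^ m ≤ (∑ k ∈ Finset.range m, |p.coeff k|) * |r| ^ (m - 1) := by
    have h2 : r ^ m = -∑ k ∈ Finset.range m, p.coeff k * r ^ k := by linarith
    calc |r| ^ m = |r ^ m| := (abs_pow r m).symm
      _ = |∑ k ∈ Finset.range m, p.coeff k * r ^ k| := by rw [h2, abs_neg]
      _ ≤ ∑ k ∈ Finset.range m, |p.coeff k * r ^ k| := Finset.abs_sum_le_sum_abs _ _
      _ ≤ ∑ k ∈ Finset.range m, |p.coeff k| * |r| ^ (m - 1) := by
          refine Finset.sum_le_sum fun k hk => ?_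
          rw [abs_mul, abs_pow]
          refine mul_le_mul_of_nonneg_left ?_ (abs_nonneg _)
          exact pow_le_pow_right₀ h1.le (by have := Finset.mem_range.1 hk; omega)
      _ = (∑ k ∈ Finset.range m, |p.coeff k|) * |r| ^ (m - 1) := by rw [Finset.sum_mul]
  have hpos : 0 < |r| ^ (m - 1) := pow_pos (by linarith) _
  have hpow : |r| ^ m = |r| * |r| ^ (m - 1) := by
    rw [← pow_succ', Nat.sub_add_cancel hm0]
  rw [hpow] at hle
  have : |r| ≤ ∑ k ∈ Finset.range m, |p.coeff k| := le_of_mul_le_mul_right hle hpos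
  linarith

/-! ### The sorted enumeration of the roots -/

/-- A list is the map of its `getD` over `range length`. [folklore] -/
theorem list_eq_map_getD_range (l : List ℝ) : l = (List.range l.length).map (fun k => l.getD k 0) := by
  refine List.ext_getElem (by simp) fun k h₁ h₂ => ?_
  rw [List.getElem_map, List.getElem_range, List.getD_eq_getElem _ _ h₁]

/-- The sorted root list of a real-rooted polynomial has `natDegree` entries. [folklore] -/
theorem sort_roots_length (p : ℝ[X]) (hs : p.Splits) : (p.roots.sort (· ≤ ·)).length = p.natDegree := by
  rw [Multiset.length_sort, splits_iff_card_roots.1 hs]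

/-- **The roots are enumerated, with multiplicity, by the sorted root list.** [folklore] -/
theorem roots_eq_map_sortedRoot (p : ℝ[X]) (hs : p.Splits) :
    p.roots = (Finset.range p.natDegree).val.map (fun k => (p.roots.sort (· ≤ ·)).getD k 0) := by
  conv_lhs => rw [← Multiset.sort_eq p.roots (· ≤ ·), list_eq_map_getD_range (p.roots.sort (· ≤ ·)),
    sort_roots_length p hs]
  rw [Finset.range_val, ← Multiset.coe_range, Multiset.map_coe]

/-- Consecutive sorted roots are ordered. [folklore] -/
theorem sortedRoot_le_succ (p : ℝ[X]) (hs : p.Splits) {k : ℕ} (hk : k + 1 < p.natDegree) :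
    (p.roots.sort (· ≤ ·)).getD k 0 ≤ (p.roots.sort (· ≤ ·)).getD (k + 1) 0 := by
  have hlen := sort_roots_length p hs
  have h1 : k < (p.roots.sort (· ≤ ·)).length := by omega
  have h2 : k + 1 < (p.roots.sort (· ≤ ·)).length := by omega
  rw [List.getD_eq_getElem _ _ h1, List.getD_eq_getElem _ _ h2]
  have hpw := Multiset.pairwise_sort p.roots (· ≤ ·)
  exact List.Pairwise.rel_get_of_lt hpw (a := ⟨k, h1⟩) (b := ⟨k + 1, h2⟩) (by simp)

/-- Each sorted root is a root. [folklore] -/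
theorem isRoot_sortedRoot (p : ℝ[X]) (hs : p.Splits) (hp : p ≠ 0) {k : ℕ} (hk : k < p.natDegree) :
    p.IsRoot ((p.roots.sort (· ≤ ·)).getD k 0) := by
  have h1 : k < (p.roots.sort (· ≤ ·)).length := by rw [sort_roots_length p hs]; exact hk
  rw [List.getD_eq_getElem _ _ h1]
  have hmem : (p.roots.sort (· ≤ ·))[k] ∈ p.roots := by
    rw [← Multiset.mem_sort (r := (· ≤ ·))]
    exact List.getElem_mem h1
  exact (mem_roots hp).1 hmem

/-- The product form: `p(y) = Π_{k < deg} (y − β_k)` for a monic real-rooted `p`. [folklore] -/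
theorem eval_eq_prod_sortedRoot (p : ℝ[X]) (hs : p.Splits) (hmon : p.Monic) (y : ℝ) :
    p.eval y = ∏ k ∈ Finset.range p.natDegree, (y - (p.roots.sort (· ≤ ·)).getD k 0) := by
  rw [hs.eval_eq_prod_roots_of_monic hmon, Finset.prod_eq_multiset_prod]
  conv_lhs => rw [roots_eq_map_sortedRoot p hs, Multiset.map_map]
  rfl

/-! ### Limit identification -/

/-- A chain condition on consecutive indices gives monotonicity below `m`. [folklore] -/
theorem le_of_chain {σ : ℕ → ℝ} {m : ℕ} (hsorted : ∀ k, k + 1 < m → σ k ≤ σ (k + 1)) :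
    ∀ i j, i ≤ j → j < m → σ i ≤ σ j := by
  intro i j hij hj
  induction j, hij using Nat.le_induction with
  | base => exact le_rfl
  | succ j hij ih => exact (ih (by omega)).trans (hsorted j hj)

/-- **Limit identification.**  If `p_n(y) = Π_{k<m} (y − v_n k)` for every `y`, `p_n(y) → q(y)` pointwise, `v_n k → σ k`, and
`σ` is sorted, then `q = Π_{k<m} (X − σ_k)` and the sorted roots of `q` are `σ_0, …, σ_{m−1}`. [folklore] -/
theorem sortedRoot_eq_of_tendsto {m : ℕ} (p : ℕ → ℝ[X]) (q : ℝ[X]) (v : ℕ → ℕ → ℝ) (σ : ℕ → ℝ)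
    (hpeval : ∀ n y, (p n).eval y = ∏ k ∈ Finset.range m, (y - v n k))
    (hq : ∀ y, Tendsto (fun n => (p n).eval y) atTop (𝓝 (q.eval y)))
    (hv : ∀ k, k < m → Tendsto (fun n => v n k) atTop (𝓝 (σ k)))
    (hsorted : ∀ k, k + 1 < m → σ k ≤ σ (k + 1)) :
    q = ∏ k ∈ Finset.range m, (X - Polynomial.C (σ k)) ∧
      ∀ k, k < m → (q.roots.sort (· ≤ ·)).getD k 0 = σ k := by
  -- the limit polynomial
  have hqeq : q = ∏ k ∈ Finset.range m, (X - Polynomial.C (σ k)) := by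
    refine Polynomial.funext fun y => ?_
    have hlim : Tendsto (fun n => (p n).eval y) atTop (𝓝 (∏ k ∈ Finset.range m, (y - σ k))) := by
      have h : Tendsto (fun n => ∏ k ∈ Finset.range m, (y - v n k)) atTop (𝓝 (∏ k ∈ Finset.range m, (y - σ k))) :=
        tendsto_finsetProd _ fun k hk => tendsto_const_nhds.sub (hv k (Finset.mem_range.1 hk))
      exact h.congr fun n => (hpeval n y).symm
    rw [tendsto_nhds_unique (hq y) hlim, eval_prod]
    simp only [eval_sub, eval_X, eval_C]
  refine ⟨hqeq, fun k hk => ?_⟩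
  -- roots of the limit, as a multiset and as a sorted list
  have hroots : q.roots = (((List.range m).map σ : List ℝ) : Multiset ℝ) := by
    have hprod : ∏ k ∈ Finset.range m, (X - Polynomial.C (σ k)) =
        (((Finset.range m).val.map σ).map fun a => X - Polynomial.C a).prod := by
      rw [Multiset.map_map, Finset.prod_eq_multiset_prod]
      rfl
    rw [hqeq, hprod, roots_multiset_prod_X_sub_C, Finset.range_val, ← Multiset.coe_range, Multiset.map_coe]
  have hpw : ((List.range m).map σ).Pairwise (· ≤ ·) := by
    rw [List.pairwise_map]
    exact List.pairwise_lt_range.imp_of_mem fun {a b} _ hb hab =>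
      le_of_chain hsorted a b hab.le (List.mem_range.1 hb)
  have hsort : q.roots.sort (· ≤ ·) = (List.range m).map σ := by
    rw [hroots, Multiset.coe_sort]
    exact List.mergeSort_eq_self _ hpw
  have hlen : k < ((List.range m).map σ).length := by simpa using hk
  rw [hsort, List.getD_eq_getElem _ _ hlen, List.getElem_map, List.getElem_range]

/-! ### The package: continuous sorted root functions -/

/-- **Sorted roots of a monic real-rooted family are continuous.**  For `P : ℝ → ℝ[X]` monic of constant degree `m`,
real-rooted and coefficientwise continuous on `U`, there are root functions `β 0, …, β (m−1)` enumerating the roots with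
multiplicity (`(P t).roots = Σ_k {β k t}`), sorted (`β k t ≤ β (k+1) t`), and continuous on `U`. [folklore] -/
theorem exists_sortedRoots (P : ℝ → ℝ[X]) (U : Set ℝ) (m : ℕ)
    (hmonic : ∀ t ∈ U, (P t).Monic) (hdeg : ∀ t ∈ U, (P t).natDegree = m) (hsplit : ∀ t ∈ U, (P t).Splits)
    (hcoef : ∀ k, ContinuousOn (fun t => (P t).coeff k) U) :
    ∃ β : ℕ → ℝ → ℝ,
      (∀ t ∈ U, (P t).roots = (Finset.range m).val.map (fun k => β k t)) ∧
      (∀ t ∈ U, ∀ k, k + 1 < m → β k t ≤ β (k + 1) t) ∧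
      (∀ t ∈ U, ∀ k, k < m → (P t).IsRoot (β k t)) ∧
      (∀ k, k < m → ContinuousOn (β k) U) := by
  classical
  refine ⟨fun k t => ((P t).roots.sort (· ≤ ·)).getD k 0, ?_, ?_, ?_, ?_⟩
  · intro t ht
    have h := roots_eq_map_sortedRoot (P t) (hsplit t ht)
    rwa [hdeg t ht] at h
  · intro t ht k hk
    exact sortedRoot_le_succ (P t) (hsplit t ht) (by rw [hdeg t ht]; exact hk)
  · intro t ht k hk
    exact isRoot_sortedRoot (P t) (hsplit t ht) (hmonic t ht).ne_zero (by rw [hdeg t ht]; exact hk)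
  · intro k hk t₀ ht₀
    -- sequential continuity: every sequence has a subsequence along which `β k → β k t₀`
    refine tendsto_of_subseq_tendsto fun ns hns => ?_
    rw [tendsto_nhdsWithin_iff] at hns
    obtain ⟨hns, hU⟩ := hns
    obtain ⟨N₀, hN₀⟩ := eventually_atTop.1 hU
    -- shifted sequence inside `U`
    set t : ℕ → ℝ := fun n => ns (n + N₀) with ht_def
    have htU : ∀ n, t n ∈ U := fun n => hN₀ _ (Nat.le_add_left _ _)
    have ht_tend : Tendsto t atTop (𝓝 t₀) := hns.comp (tendsto_add_atTop_nat N₀)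
    -- coefficient convergence along `t`
    have hcoef_t : ∀ j, Tendsto (fun n => (P (t n)).coeff j) atTop (𝓝 ((P t₀).coeff j)) := by
      intro j
      have h := (hcoef j t₀ ht₀).tendsto.comp
        (tendsto_nhdsWithin_iff.2 ⟨ht_tend, Eventually.of_forall htU⟩)
      exact h
    -- root vectors and their uniform bound
    set v : ℕ → ℕ → ℝ := fun n j => ((P (t n)).roots.sort (· ≤ ·)).getD j 0 with hv_def
    have hbound_seq : Tendsto (fun n => 1 + ∑ j ∈ Finset.range m, |(P (t n)).coeff j|) atTop
        (𝓝 (1 + ∑ j ∈ Finset.range m, |(P t₀).coeff j|)) :=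
      tendsto_const_nhds.add (tendsto_finsetSum _ fun j _ => (hcoef_t j).abs)
    obtain ⟨B, hB⟩ := hbound_seq.bddAbove_range
    have hvB : ∀ n j, j < m → |v n j| ≤ B := by
      intro n j hj
      have hroot := isRoot_sortedRoot (P (t n)) (hsplit _ (htU n)) (hmonic _ (htU n)).ne_zero
        (by rw [hdeg _ (htU n)]; exact hj)
      have h := abs_le_of_isRoot_of_monic (P (t n)) (hmonic _ (htU n)) hroot
      rw [hdeg _ (htU n)] at h
      exact h.trans (hB ⟨n, rfl⟩)
    -- Bolzano–Weierstrass on the vectors `w n : Fin m → ℝ`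
    set w : ℕ → (Fin m → ℝ) := fun n i => v n i with hw_def
    have hwball : ∀ n, w n ∈ Metric.closedBall (0 : Fin m → ℝ) (max B 0) := by
      intro n
      rw [Metric.mem_closedBall, dist_zero_right, pi_norm_le_iff_of_nonneg (le_max_right _ _)]
      intro i
      rw [Real.norm_eq_abs]
      exact (hvB n i i.2).trans (le_max_left _ _)
    obtain ⟨σ, -, φ, hφ, hwφ⟩ := tendsto_subseq_of_bounded Metric.isBounded_closedBall hwball
    -- coordinatewise limits, extended to `ℕ`
    set σ' : ℕ → ℝ := fun j => if h : j < m then σ ⟨j, h⟩ else 0 with hσ'_def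
    have hvσ : ∀ j, j < m → Tendsto (fun n => v (φ n) j) atTop (𝓝 (σ' j)) := by
      intro j hj
      have h := (tendsto_pi_nhds.1 hwφ) ⟨j, hj⟩
      simp only [hσ'_def, dif_pos hj]
      exact h
    -- limit identification along the subsequence
    have hsortedσ : ∀ j, j + 1 < m → σ' j ≤ σ' (j + 1) := by
      intro j hj
      exact le_of_tendsto_of_tendsto' (hvσ j (by omega)) (hvσ (j + 1) hj) fun n =>
        sortedRoot_le_succ (P (t (φ n))) (hsplit _ (htU _)) (by rw [hdeg _ (htU _)]; exact hj)
    have hid := sortedRoot_eq_of_tendsto (fun n => P (t (φ n))) (P t₀) (fun n => v (φ n)) σ'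
      (fun n y => by
        have h := eval_eq_prod_sortedRoot (P (t (φ n))) (hsplit _ (htU _)) (hmonic _ (htU _)) y
        rw [hdeg _ (htU _)] at h
        exact h)
      (fun y => by
        -- pointwise evaluation is continuous in the coefficients (degree `m` on `U`)
        have hP : ∀ s ∈ U, (P s).eval y = ∑ j ∈ Finset.range (m + 1), (P s).coeff j * y ^ j := fun s hs =>
          eval_eq_sum_range' (by rw [hdeg s hs]; exact Nat.lt_succ_self m) y
        have h : Tendsto (fun n => ∑ j ∈ Finset.range (m + 1), (P (t (φ n))).coeff j * y ^ j) atTop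
            (𝓝 (∑ j ∈ Finset.range (m + 1), (P t₀).coeff j * y ^ j)) :=
          tendsto_finsetSum _ fun j _ => ((hcoef_t j).comp hφ.tendsto_atTop).mul tendsto_const_nhds
        rw [← hP t₀ ht₀] at h
        exact h.congr fun n => (hP _ (htU _)).symm)
      hvσ hsortedσ
    refine ⟨fun n => φ n + N₀, ?_⟩
    have hgoal : Tendsto (fun n => v (φ n) k) atTop (𝓝 (((P t₀).roots.sort (· ≤ ·)).getD k 0)) := by
      rw [hid.2 k hk]
      exact hvσ k hk
    exact hgoal

end OsculationPeel

end Summit.ValiantsHypothesis.ValiantsHypothesis.Theorems.LacunarySymmetroidMatrixDescartes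

end
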